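import Summits.BirchSwinnertonDyer.BirchSwinnertonDyer.Theorems.ByReductionTypeAtTwoSupersingularFlatNoFiniteSubmoduleOfClassicalRank
import Summits.BirchSwinnertonDyer.Rank1Residual.F1Sign2.HondaSystemAtTwo
import HarnessLib

/-!
# Route `ByReductionTypeAtTwo` (rung K4), crux `SupersingularRankZeroAtTwo` (item stmt-BirchSwinnertonDyer-19097), line
# `odd_blind_package`, slot 4 NF♭ — **the HONDA-GUARDED form** (REF1 R454b-type guard of the free local data `c`): NF♭ for
# Honda–Sprung data `(g, c)` that ARE (the `c`-part of) a Honda system at two, from (hA) classical NF at supersingular `2` and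
# (hC_H) the cyclic kernel of `X ↠ X♭` asked ONLY for such data (cell `bsd-2adic`, LEAD ss-1 GEN 23; `--supports 19097`, helper)

HONEST FRAMING: THEOREMS ONLY (no definition, no named fact, no `sorry`, no instance).  WHY THIS FILE: the registry's slot 4
`FlatNoFiniteSubmoduleAtTwo` (v2.11 :502–523) quantifies over ALL local data `(g, c)` subject to the layer / trace / level-0 clauses
`hc`, `htr`, `hz`, `hsat` but NOT the Honda legality clause `∃ cneg, F1Sign2.IsHondaSystemAtTwo κ ι W a₂ g cneg c` that stub 2 (v2.7+)
produces and that slot 5's `…HondaAtTwo` statements carry; the input (hC) «`ker(X ↠ X♭)` is cyclic» rests on the structure of `Ker Col♭`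
(Sprung's Coleman map needs the Honda relations incl. the bottom one with `c₋`), so a hand for (hC) must be typed WITH the Honda clause —
and then the composition must carry it too.  This file is that composition: the conclusion is the body of `FlatNoFiniteSubmoduleAtTwo`
with the Honda clause inserted after (SAT) (exactly as `FlatBlindRegulatorCharacteristicHondaAtTwo` inserts it into K67-A), which is
all that `flatBlindRegulatorCharacteristicHondaAtTwo_of` ever applies (its `hNF` is used at :1255 with `hH` in context) — a v2.13
reshape «stub 4 ↦ `FlatNoFiniteSubmoduleHondaAtTwo`» (ζ) is count-neutral and WEAKENS the stub.  (hA) is Honda-free (classical `X`).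
Neither input is asserted; 19097 stays OPEN; nothing is booked; BSD is proved for no curve.  bears_on: K4 (19097).

* ★★ `flatNoFiniteSubmoduleHondaAtTwo_of_classical_of_kernelCyclic (hA) (hCH)` — NF♭_H ⟸ (hA) + (hC_H); (hB) «rank ≥ 1» is the tree
  theorem `OddBlindNF.exists_nonTorsion_classical_of_goodSS_two` (p822496); algebra = Kitajima–Otsuki Prop. 4.6 + 4.7 in rank one
  (`Rank1Residual.Iwasawa.forall_finite_eq_bot_of_surjective_of_ker_eq_range_of_injective`).
* `flatNoFiniteSubmoduleHondaAtTwo_of_unguarded (h)` — the guarded statement from the registry's unguarded one (forget `hH`).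

References: [KitajimaOtsuki2018] Prop. 4.6, 4.7, Thm. 4.8 (arXiv:1607.03612 p. 19); [GreenbergLNM1716] Thm. 1.7, pp. 104–105;
[Sprung2012] Thm. 2.2, Def. 5.9, Def. 7.9 / 7.11.
-/

set_option autoImplicit false
-- the Theorems namespace of this sub repeats the summit name by design (D-0017 nested layout)
set_option linter.dupNamespace false

noncomputable section

open scoped Classical NumberField
open NumberField IsDedekindDomain WeierstrassCurve Literature.NumberTheory.EllipticCurves
  Literature.NumberTheory.EllipticCurves.Sprung2017 Literature.NumberTheory.EllipticCurves.Sprung2012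
  Literature.NumberTheory.EllipticCurves.Rank1Residual Literature.NumberTheory.EllipticCurves.Rank1Residual.Typed
  Literature.NumberTheory.EllipticCurves.Kobayashi2003 Literature.NumberTheory.EllipticCurves.IwasawaDual
  Literature.NumberTheory.GaloisRepresentations
  ZpExtension Summit.BirchSwinnertonDyer.Rank1Residual Summit.BirchSwinnertonDyer.Rank1Residual.Supersingular

namespace Summit.BirchSwinnertonDyer.BirchSwinnertonDyer.Theorems

namespace OddBlindNF

/-- ★★ **NF♭_H ⟸ (hA) classical NF at supersingular `2` + (hC_H) «`ker(X ↠ X♭)` is CYCLIC» for Honda-legal data.**  Conclusion = the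
body of `OddBlindPackage.FlatNoFiniteSubmoduleAtTwo` with the Honda clause `∃ cneg, F1Sign2.IsHondaSystemAtTwo κ ι W a₂ g cneg c` inserted
after (SAT).  Proof as `flatNoFiniteSubmoduleAtTwo_of_classical` (p822368) with `hH` threaded into (hC_H): classical dual
`S = W.selmerDualData κ hγ` (f.g.), canonical surjection `π : S.X ↠ D.X` over `Sel♭ ≤ Sel`, cyclic kernel `Λ ∙ x₀` as the range of
`a ↦ a 0 • x₀`, a non-torsion `y` from Greenberg Thm. 1.7 (`exists_nonTorsion_classical_of_goodSS_two`), then Kitajima–Otsuki 4.6 + 4.7.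
[cite: KitajimaOtsuki2018, Prop. 4.6, 4.7, Thm. 4.8 (arXiv:1607.03612 p. 19)] [cite: GreenbergLNM1716, Thm. 1.7 and pp. 104–105] -/
theorem flatNoFiniteSubmoduleHondaAtTwo_of_classical_of_kernelCyclic
    (hA : ∀ (W : WeierstrassCurve ℚ) [W.IsElliptic] [W.IsGloballyMinimal], GoodSS W 2 →
      ∀ (κ : ZpExtension ℚ 2) (γ : Field.absoluteGaloisGroup ℚ),
        κ.IsCyclotomic → κ.IsTopGenerator γ → IsCyclotomicVariable 2 γ →
      ∀ (S : W.SelmerDualData κ γ) [Module.Finite (IwasawaAlgebra 2) S.X],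
        ∀ N : Submodule (IwasawaAlgebra 2) S.X, Finite N → N = ⊥)
    (hCH : ∀ (W : WeierstrassCurve ℚ) [W.IsElliptic] [W.IsGloballyMinimal], GoodSS W 2 →
      ∀ (κ : ZpExtension ℚ 2) (γ : Field.absoluteGaloisGroup ℚ),
        κ.IsCyclotomic → κ.IsTopGenerator γ → IsCyclotomicVariable 2 γ →
      ∀ (v : HeightOneSpectrum (𝓞 ℚ)), (2 : 𝓞 ℚ) ∈ v.asIdeal →
      ∀ (g : Field.absoluteGaloisGroup (v.adicCompletion ℚ)) (c : ℕ → localPoints W (v.adicCompletion ℚ)),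
        κ.IsTopGenerator (resGalOfEmb (closureEmb (K := ℚ) (v.adicCompletion ℚ)) g) →
        (∀ n, c n ∈ localLayerPointsOfEmb κ (closureEmb (K := ℚ) (v.adicCompletion ℚ)) W n) →
        (∀ n, 1 ≤ n → localTraceOfEmb κ (closureEmb (K := ℚ) (v.adicCompletion ℚ)) W n (n + 1)
          (c (n + 1)) = W.frobeniusTrace 2 • c n - c (n - 1)) →
        (∀ z₀ : localLayerPointsOfEmb κ (closureEmb (K := ℚ) (v.adicCompletion ℚ)) W 0 →+ ℤ_[2],
          evalOn W (localLayerPointsOfEmb κ (closureEmb (K := ℚ) (v.adicCompletion ℚ)) W 0) z₀ (c 0) = 0 →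
            z₀ = 0) →
        (∀ a : ℤ_[2],
          (∃ z₀ : localLayerPointsOfEmb κ (closureEmb (K := ℚ) (v.adicCompletion ℚ)) W 0 →+ ℤ_[2],
            evalOn W (localLayerPointsOfEmb κ (closureEmb (K := ℚ) (v.adicCompletion ℚ)) W 0) z₀ (c 0) = 2 * a) →
          ∃ y : localLayerPointsOfEmb κ (closureEmb (K := ℚ) (v.adicCompletion ℚ)) W 0 →+ ℤ_[2],
            evalOn W (localLayerPointsOfEmb κ (closureEmb (K := ℚ) (v.adicCompletion ℚ)) W 0) y (c 0) = a) →
        (∃ cneg : localPoints W (v.adicCompletion ℚ),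
          Summit.BirchSwinnertonDyer.Rank1Residual.F1Sign2.IsHondaSystemAtTwo κ (closureEmb (K := ℚ) (v.adicCompletion ℚ)) W
            (W.frobeniusTrace 2) g cneg c) →
      ∀ (D : SharpFlatSelmerDualData W κ γ (closureEmb (K := ℚ) (v.adicCompletion ℚ))
          (W.frobeniusTrace 2) g c .flat) [Module.Finite (IwasawaAlgebra 2) D.X],
        Module.IsTorsion (IwasawaAlgebra 2) D.X →
      ∀ (S : W.SelmerDualData κ γ) [Module.Finite (IwasawaAlgebra 2) S.X]
        (π : S.X →ₗ[IwasawaAlgebra 2] D.X),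
        (∀ (x : S.X) (s : sharpFlatSelmerInfty W κ (closureEmb (K := ℚ) (v.adicCompletion ℚ)) (W.frobeniusTrace 2) g c .flat),
          D.toDual (π x) s = S.toDual x (AddSubgroup.inclusion
            (sharpFlatSelmerInfty_le_selmerInfty W κ (closureEmb (K := ℚ) (v.adicCompletion ℚ)) (W.frobeniusTrace 2) g c .flat) s)) →
        ∃ x₀ : S.X, LinearMap.ker π = Submodule.span (IwasawaAlgebra 2) {x₀})
    :
    ∀ (W : WeierstrassCurve ℚ) [W.IsElliptic] [W.IsGloballyMinimal], GoodSS W 2 →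
    ∀ (κ : ZpExtension ℚ 2) (γ : Field.absoluteGaloisGroup ℚ),
        κ.IsCyclotomic → κ.IsTopGenerator γ → IsCyclotomicVariable 2 γ →
      ∀ (v : HeightOneSpectrum (𝓞 ℚ)), (2 : 𝓞 ℚ) ∈ v.asIdeal →
      ∀ (g : Field.absoluteGaloisGroup (v.adicCompletion ℚ)) (c : ℕ → localPoints W (v.adicCompletion ℚ)),
        κ.IsTopGenerator (resGalOfEmb (closureEmb (K := ℚ) (v.adicCompletion ℚ)) g) →
        (∀ n, c n ∈ localLayerPointsOfEmb κ (closureEmb (K := ℚ) (v.adicCompletion ℚ)) W n) →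
        (∀ n, 1 ≤ n → localTraceOfEmb κ (closureEmb (K := ℚ) (v.adicCompletion ℚ)) W n (n + 1)
          (c (n + 1)) = W.frobeniusTrace 2 • c n - c (n - 1)) →
        (∀ z₀ : localLayerPointsOfEmb κ (closureEmb (K := ℚ) (v.adicCompletion ℚ)) W 0 →+ ℤ_[2],
          evalOn W (localLayerPointsOfEmb κ (closureEmb (K := ℚ) (v.adicCompletion ℚ)) W 0) z₀ (c 0) = 0 →
            z₀ = 0) →
        (∀ a : ℤ_[2],
          (∃ z₀ : localLayerPointsOfEmb κ (closureEmb (K := ℚ) (v.adicCompletion ℚ)) W 0 →+ ℤ_[2],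
            evalOn W (localLayerPointsOfEmb κ (closureEmb (K := ℚ) (v.adicCompletion ℚ)) W 0) z₀ (c 0) = 2 * a) →
          ∃ y : localLayerPointsOfEmb κ (closureEmb (K := ℚ) (v.adicCompletion ℚ)) W 0 →+ ℤ_[2],
            evalOn W (localLayerPointsOfEmb κ (closureEmb (K := ℚ) (v.adicCompletion ℚ)) W 0) y (c 0) = a) →
        (∃ cneg : localPoints W (v.adicCompletion ℚ),
          Summit.BirchSwinnertonDyer.Rank1Residual.F1Sign2.IsHondaSystemAtTwo κ (closureEmb (K := ℚ) (v.adicCompletion ℚ)) W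
            (W.frobeniusTrace 2) g cneg c) →
      ∀ (D : SharpFlatSelmerDualData W κ γ (closureEmb (K := ℚ) (v.adicCompletion ℚ))
          (W.frobeniusTrace 2) g c .flat) [Module.Finite (IwasawaAlgebra 2) D.X],
        Module.IsTorsion (IwasawaAlgebra 2) D.X →
      ∀ N : Submodule (IwasawaAlgebra 2) D.X, Finite N → N = ⊥ := by
  intro W _ _ hss κ γ hκ hγ hcyc v hv g c hg hc htr hz hsat hH D _ htors
  let S : W.SelmerDualData κ γ := W.selmerDualData κ hγ
  haveI : Module.Finite (IwasawaAlgebra 2) S.X := S.module_finite_holds hγ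
  obtain ⟨π, hπ, hpin⟩ := SharpFlatSelmerDualData.exists_linearMap_ofSelmerDual (W := W) (κ := κ)
    (ι := closureEmb (K := ℚ) (v.adicCompletion ℚ)) (ap := W.frobeniusTrace 2) (g := g) (c := c) (col := .flat) S D
  obtain ⟨x₀, hx₀⟩ := hCH W hss κ γ hκ hγ hcyc v hv g c hg hc htr hz hsat hH D htors S π hpin
  have hker : LinearMap.ker π = LinearMap.range ((LinearMap.toSpanSingleton (IwasawaAlgebra 2) S.X x₀).comp
      (LinearMap.proj (0 : Fin 1) : (Fin 1 → IwasawaAlgebra 2) →ₗ[IwasawaAlgebra 2] IwasawaAlgebra 2)) := by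
    rw [range_toSpanSingleton_comp_proj, hx₀]
  obtain ⟨y, hy⟩ := exists_nonTorsion_classical_of_goodSS_two W hss κ γ hκ hγ hcyc S
  exact Rank1Residual.Iwasawa.forall_finite_eq_bot_of_surjective_of_ker_eq_range_of_injective 2 (hA W hss κ γ hκ hγ hcyc S)
    _ (injective_toSpanSingleton_comp_proj hy) _ π hπ hker htors

/-- **The Honda-guarded NF♭ from the registry's unguarded NF♭** (forget the Honda clause) — so v2.11's `stub_NFflat` implies the
guarded statement, and a v2.13 reshape (ζ) «stub 4 ↦ the guarded form» only WEAKENS the stub. [folklore] -/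
theorem flatNoFiniteSubmoduleHondaAtTwo_of_unguarded
    (h :
    ∀ (W : WeierstrassCurve ℚ) [W.IsElliptic] [W.IsGloballyMinimal], GoodSS W 2 →
    ∀ (κ : ZpExtension ℚ 2) (γ : Field.absoluteGaloisGroup ℚ),
        κ.IsCyclotomic → κ.IsTopGenerator γ → IsCyclotomicVariable 2 γ →
      ∀ (v : HeightOneSpectrum (𝓞 ℚ)), (2 : 𝓞 ℚ) ∈ v.asIdeal →
      ∀ (g : Field.absoluteGaloisGroup (v.adicCompletion ℚ)) (c : ℕ → localPoints W (v.adicCompletion ℚ)),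
        κ.IsTopGenerator (resGalOfEmb (closureEmb (K := ℚ) (v.adicCompletion ℚ)) g) →
        (∀ n, c n ∈ localLayerPointsOfEmb κ (closureEmb (K := ℚ) (v.adicCompletion ℚ)) W n) →
        (∀ n, 1 ≤ n → localTraceOfEmb κ (closureEmb (K := ℚ) (v.adicCompletion ℚ)) W n (n + 1)
          (c (n + 1)) = W.frobeniusTrace 2 • c n - c (n - 1)) →
        (∀ z₀ : localLayerPointsOfEmb κ (closureEmb (K := ℚ) (v.adicCompletion ℚ)) W 0 →+ ℤ_[2],
          evalOn W (localLayerPointsOfEmb κ (closureEmb (K := ℚ) (v.adicCompletion ℚ)) W 0) z₀ (c 0) = 0 →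
            z₀ = 0) →
        (∀ a : ℤ_[2],
          (∃ z₀ : localLayerPointsOfEmb κ (closureEmb (K := ℚ) (v.adicCompletion ℚ)) W 0 →+ ℤ_[2],
            evalOn W (localLayerPointsOfEmb κ (closureEmb (K := ℚ) (v.adicCompletion ℚ)) W 0) z₀ (c 0) = 2 * a) →
          ∃ y : localLayerPointsOfEmb κ (closureEmb (K := ℚ) (v.adicCompletion ℚ)) W 0 →+ ℤ_[2],
            evalOn W (localLayerPointsOfEmb κ (closureEmb (K := ℚ) (v.adicCompletion ℚ)) W 0) y (c 0) = a) →
      ∀ (D : SharpFlatSelmerDualData W κ γ (closureEmb (K := ℚ) (v.adicCompletion ℚ))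
          (W.frobeniusTrace 2) g c .flat) [Module.Finite (IwasawaAlgebra 2) D.X],
        Module.IsTorsion (IwasawaAlgebra 2) D.X →
      ∀ N : Submodule (IwasawaAlgebra 2) D.X, Finite N → N = ⊥) :
    ∀ (W : WeierstrassCurve ℚ) [W.IsElliptic] [W.IsGloballyMinimal], GoodSS W 2 →
    ∀ (κ : ZpExtension ℚ 2) (γ : Field.absoluteGaloisGroup ℚ),
        κ.IsCyclotomic → κ.IsTopGenerator γ → IsCyclotomicVariable 2 γ →
      ∀ (v : HeightOneSpectrum (𝓞 ℚ)), (2 : 𝓞 ℚ) ∈ v.asIdeal →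
      ∀ (g : Field.absoluteGaloisGroup (v.adicCompletion ℚ)) (c : ℕ → localPoints W (v.adicCompletion ℚ)),
        κ.IsTopGenerator (resGalOfEmb (closureEmb (K := ℚ) (v.adicCompletion ℚ)) g) →
        (∀ n, c n ∈ localLayerPointsOfEmb κ (closureEmb (K := ℚ) (v.adicCompletion ℚ)) W n) →
        (∀ n, 1 ≤ n → localTraceOfEmb κ (closureEmb (K := ℚ) (v.adicCompletion ℚ)) W n (n + 1)
          (c (n + 1)) = W.frobeniusTrace 2 • c n - c (n - 1)) →
        (∀ z₀ : localLayerPointsOfEmb κ (closureEmb (K := ℚ) (v.adicCompletion ℚ)) W 0 →+ ℤ_[2],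
          evalOn W (localLayerPointsOfEmb κ (closureEmb (K := ℚ) (v.adicCompletion ℚ)) W 0) z₀ (c 0) = 0 →
            z₀ = 0) →
        (∀ a : ℤ_[2],
          (∃ z₀ : localLayerPointsOfEmb κ (closureEmb (K := ℚ) (v.adicCompletion ℚ)) W 0 →+ ℤ_[2],
            evalOn W (localLayerPointsOfEmb κ (closureEmb (K := ℚ) (v.adicCompletion ℚ)) W 0) z₀ (c 0) = 2 * a) →
          ∃ y : localLayerPointsOfEmb κ (closureEmb (K := ℚ) (v.adicCompletion ℚ)) W 0 →+ ℤ_[2],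
            evalOn W (localLayerPointsOfEmb κ (closureEmb (K := ℚ) (v.adicCompletion ℚ)) W 0) y (c 0) = a) →
        (∃ cneg : localPoints W (v.adicCompletion ℚ),
          Summit.BirchSwinnertonDyer.Rank1Residual.F1Sign2.IsHondaSystemAtTwo κ (closureEmb (K := ℚ) (v.adicCompletion ℚ)) W
            (W.frobeniusTrace 2) g cneg c) →
      ∀ (D : SharpFlatSelmerDualData W κ γ (closureEmb (K := ℚ) (v.adicCompletion ℚ))
          (W.frobeniusTrace 2) g c .flat) [Module.Finite (IwasawaAlgebra 2) D.X],
        Module.IsTorsion (IwasawaAlgebra 2) D.X →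
      ∀ N : Submodule (IwasawaAlgebra 2) D.X, Finite N → N = ⊥ := by
  intro W _ _ hss κ γ hκ hγ hcyc v hv g c hg hc htr hz hsat _hH D _ htors
  exact h W hss κ γ hκ hγ hcyc v hv g c hg hc htr hz hsat D htors

end OddBlindNF

end Summit.BirchSwinnertonDyer.BirchSwinnertonDyer.Theorems

end
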